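import Literature.Analysis.FluidPDE.ElgindiStripDilation
import Mathlib.Analysis.Calculus.MeanValue
import Mathlib.Analysis.SpecialFunctions.ExpDeriv
import Mathlib.MeasureTheory.Integral.DominatedConvergence
import HarnessLib

/-!
# Radial regularity of weak solutions: difference quotients along dilations
([Elgindi2021] §7, "`L` commutes with `D_R`"; [EGM] proof of Theorem 3)

Topic `Literature/Analysis/FluidPDE`. Support file (definitions with bodies and proved theorems, no
named facts) on the proof path of the named fact
`Literature.Analysis.FluidPDE.Elgindi.ElgindiGhoulMasmoudi2021_stabilityCore`
(`ElgindiStabilityDecomposition.lean`). T. M. Elgindi, Ann. of Math. 194 (2021) =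
arXiv:1904.04795, §7 (Proposition 7.1: "existence and uniqueness follows from the standard `L^p`
theory"; §7.3: "`D_R` commutes with the equation"), and Elgindi–Ghoul–Masmoudi, arXiv:1910.14071,
proof of Theorem 3 (p. 13: "`L^k_{α,T}` commutes with `D_R`").

* `IsWeakSol α F U`: `U` is a weak solution with datum `F` (in the energy space, `B(U,·) = ⟨F,·₀⟩`);
  linear, unique, `min(½,2α)‖U‖ ≤ ‖F‖`, stable under limits, dilation covariant.
* `tendsto_diffQuot_toL2`: for `f ∈ C¹_c`, `h⁻¹(f(e^h·,·) − f) → R∂_Rf` in `L²(strip)`.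
* `tendsto_diffQuot_weakSol`: the difference quotients `h⁻¹(dilE(e^h)U − U)` of the weak solution
  with datum `f` converge in `E⁴` to the weak solution with datum `R∂_Rf` (the radial derivative
  `D_RU` exists in the energy space and solves the commuted problem).
* `inner_radialDeriv_component`: `⟨(D_RU)_k, φ⟩ = −⟨U_k, φ + R∂_Rφ⟩` (`D_RU` is the distributional
  `R∂_R` of `U`, componentwise).
-/

noncomputable section

open MeasureTheory Set Real Filter Function
open _root_.Topology
open scoped ENNReal InnerProductSpace

namespace Literature.Analysis.FluidPDE

namespace Elgindi

/-! ### Weak solutions: the predicate and its algebra -/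

/-- **Weak solution with datum `F`**: `U` lies in the energy space and `B(U, Φ) = ⟨F, Φ₀⟩` for all
`Φ` in the energy space. [cite: Elgindi2021, §7.1 Proposition 7.1 (p. 19 of arXiv:1904.04795)] -/
structure IsWeakSol (α : ℝ) (F : L2Strip) (U : E4) : Prop where
  mem : U ∈ weakSpace α
  eq : ∀ Φ ∈ weakSpace α, energyForm α U Φ = ⟪F, Φ 0⟫_ℝ

namespace IsWeakSol

variable {α : ℝ}

/-- Existence (`0 < α ≤ 1`). [folklore] -/
theorem exists_of (hα : 0 < α) (hα1 : α ≤ 1) (F : L2Strip) : ∃ U, IsWeakSol α F U := by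
  obtain ⟨U, hU, hw, -⟩ := exists_weakSolution hα hα1 F
  exact ⟨U, ⟨hU, hw⟩⟩

/-- The a-priori bound `min(½,2α)‖U‖ ≤ ‖F‖`. [folklore] -/
theorem norm_le (hα : 0 < α) (hα1 : α ≤ 1) {F : L2Strip} {U : E4} (h : IsWeakSol α F U) :
    min (1 / 2) (2 * α) * ‖U‖ ≤ ‖F‖ := by
  have h1 := energyForm_coercive_weakSpace hα hα1 h.mem
  rw [h.eq U h.mem] at h1
  have h2 : ⟪F, U 0⟫_ℝ ≤ ‖F‖ * ‖U‖ :=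
    (real_inner_le_norm _ _).trans (mul_le_mul_of_nonneg_left (PiLp.norm_apply_le U 0) (norm_nonneg _))
  by_cases hn : ‖U‖ = 0
  · rw [hn, mul_zero]; exact norm_nonneg _
  · have hpos : 0 < ‖U‖ := lt_of_le_of_ne (norm_nonneg _) (Ne.symm hn)
    have h3 : min (1 / 2) (2 * α) * ‖U‖ ^ 2 ≤ ‖F‖ * ‖U‖ := h1.trans h2
    rw [sq, ← mul_assoc] at h3
    exact le_of_mul_le_mul_right h3 hpos

/-- Uniqueness. [folklore] -/
theorem unique (hα : 0 < α) (hα1 : α ≤ 1) {F : L2Strip} {U₁ U₂ : E4} (h1 : IsWeakSol α F U₁) (h2 : IsWeakSol α F U₂) : U₁ = U₂ :=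
  weakSolution_unique hα hα1 h1.mem h2.mem fun Φ hΦ => by rw [h1.eq Φ hΦ, h2.eq Φ hΦ]

/-- Linearity: sums. [folklore] -/
theorem add {F G : L2Strip} {U V : E4} (hU : IsWeakSol α F U) (hV : IsWeakSol α G V) : IsWeakSol α (F + G) (U + V) :=
  ⟨Submodule.add_mem _ hU.mem hV.mem, fun Φ hΦ => by
    rw [map_add]
    show energyForm α U Φ + energyForm α V Φ = _
    rw [hU.eq Φ hΦ, hV.eq Φ hΦ, inner_add_left]⟩

/-- Linearity: scalars. [folklore] -/
theorem smul (c : ℝ) {F : L2Strip} {U : E4} (hU : IsWeakSol α F U) : IsWeakSol α (c • F) (c • U) :=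
  ⟨Submodule.smul_mem _ c hU.mem, fun Φ hΦ => by
    rw [map_smul]
    show c * energyForm α U Φ = _
    rw [hU.eq Φ hΦ, inner_smul_left]; simp⟩

/-- Linearity: differences. [folklore] -/
theorem sub {F G : L2Strip} {U V : E4} (hU : IsWeakSol α F U) (hV : IsWeakSol α G V) : IsWeakSol α (F - G) (U - V) := by
  have h := hU.add (hV.smul (-1))
  simp only [neg_smul, one_smul, ← sub_eq_add_neg] at h
  exact h

/-- Dilation covariance. [folklore] -/
theorem dilE {a : ℝ} (ha : 0 < a) {F : L2Strip} {U : E4} (hU : IsWeakSol α F U) : IsWeakSol α (dilL2 ha F) (dilE ha U) := by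
  obtain ⟨h1, h2⟩ := weakSolution_dilE ha hU.mem hU.eq
  exact ⟨h1, h2⟩

/-- **Stability under limits**: limits of weak solutions are weak solutions. [folklore] -/
theorem of_tendsto {ι : Type*} {l : Filter ι} [l.NeBot] {F : ι → L2Strip} {U : ι → E4} {F₀ : L2Strip} {U₀ : E4}
    (h : ∀ i, IsWeakSol α (F i) (U i)) (hF : Tendsto F l (𝓝 F₀)) (hU : Tendsto U l (𝓝 U₀)) : IsWeakSol α F₀ U₀ := by
  refine ⟨(isClosed_weakSpace α).mem_of_tendsto hU (Eventually.of_forall fun i => (h i).mem), fun Φ hΦ => ?_⟩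
  have h1 : Tendsto (fun i => energyForm α (U i) Φ) l (𝓝 (energyForm α U₀ Φ)) :=
    ((energyForm α).flip Φ).continuous.tendsto U₀ |>.comp hU
  have h2 : Tendsto (fun i => ⟪F i, Φ 0⟫_ℝ) l (𝓝 ⟪F₀, Φ 0⟫_ℝ) := (continuous_id.inner continuous_const).tendsto F₀ |>.comp hF
  have e : (fun i => energyForm α (U i) Φ) = fun i => ⟪F i, Φ 0⟫_ℝ := funext fun i => (h i).eq Φ hΦ
  rw [e] at h1
  exact tendsto_nhds_unique h1 h2

end IsWeakSol

/-! ### Difference quotients of the datum -/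

/-- The set swept by the support under dilations `e^t`, `|t| ≤ 1`: a compact set outside of which
all the difference quotients vanish. [folklore] -/
theorem exists_compact_dil_sweep {f : ℝ × ℝ → ℝ} (hs : HasCompactSupport f) :
    ∃ K : Set (ℝ × ℝ), IsCompact K ∧ ∀ t ∈ Icc (-1:ℝ) 1, ∀ p, f (dil (Real.exp t) p) ≠ 0 → p ∈ K := by
  refine ⟨(fun q : ℝ × (ℝ × ℝ) => dil (Real.exp (-q.1)) q.2) '' (Icc (-1:ℝ) 1 ×ˢ tsupport f), ?_, fun t ht p hp => ?_⟩
  · refine (isCompact_Icc.prod hs.isCompact).image ?_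
    exact Continuous.prodMk ((Real.continuous_exp.comp continuous_fst.neg).mul (continuous_fst.comp continuous_snd))
      (continuous_snd.comp continuous_snd)
  · refine ⟨(t, dil (Real.exp t) p), ⟨ht, subset_tsupport _ hp⟩, ?_⟩
    show dil (Real.exp (-t)) (dil (Real.exp t) p) = p
    rw [dil_dil, ← Real.exp_add, neg_add_cancel, Real.exp_zero, dil_one]

set_option maxHeartbeats 1600000 in
/-- **`h⁻¹(f(e^h R,θ) − f(R,θ)) → R∂_Rf` in `L²(strip)`** for `f ∈ C¹` with compact support
(dominated convergence: pointwise by differentiability, dominated by `2 sup|R∂_Rf|` on a fixed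
compact set). [folklore] -/
theorem tendsto_diffQuot_toL2 {f : ℝ → ℝ → ℝ} (hf : ContDiff ℝ 1 (uncurry f)) (hs : HasCompactSupport (uncurry f)) :
    Tendsto (fun h : ℝ => toL2 fun p : ℝ × ℝ => h⁻¹ * (f (Real.exp h * p.1) p.2 - f p.1 p.2)) (𝓝[≠] 0)
      (𝓝 (toL2 fun p : ℝ × ℝ => p.1 * dz f p.1 p.2)) := by
  -- notation
  set g : ℝ → ℝ × ℝ → ℝ := fun h p => h⁻¹ * (f (Real.exp h * p.1) p.2 - f p.1 p.2) with hg
  set g₀ : ℝ × ℝ → ℝ := fun p => p.1 * dz f p.1 p.2 with hg₀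
  have cf : Continuous fun p : ℝ × ℝ => f p.1 p.2 := hf.continuous
  have cdz : Continuous fun p : ℝ × ℝ => dz f p.1 p.2 := (contDiff_dz_of_contDiff (n := 0) hf).continuous
  have cg : ∀ h, Continuous (g h) := fun h => by simp only [hg]; fun_prop
  have cg₀ : Continuous g₀ := by simp only [hg₀]; fun_prop
  have sg₀ : HasCompactSupport g₀ := (hasCompactSupport_dz hs).mul_left
  -- the bound `M = sup |R∂_Rf|`
  obtain ⟨M, hM⟩ := cg₀.bounded_above_of_compact_support sg₀
  have hM' : ∀ p : ℝ × ℝ, |p.1 * dz f p.1 p.2| ≤ M := fun p => hM p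
  have hM0 : 0 ≤ M := (abs_nonneg _).trans (hM' (0, 0))
  -- pointwise: `t ↦ f(e^t p₁, p₂)` has derivative `e^t p₁ ∂_Rf(e^t p₁, p₂)`
  have hder : ∀ (p : ℝ × ℝ) (t : ℝ), HasDerivAt (fun t => f (Real.exp t * p.1) p.2) (Real.exp t * p.1 * dz f (Real.exp t * p.1) p.2) t := by
    intro p t
    have hd : DifferentiableAt ℝ (fun R' => f R' p.2) (Real.exp t * p.1) :=
      ((hf.comp (contDiff_id.prodMk contDiff_const)).differentiable (by simp)) _
    have h1 : HasDerivAt (fun t => Real.exp t * p.1) (Real.exp t * p.1) t := by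
      simpa using (Real.hasDerivAt_exp t).mul_const p.1
    have h := hd.hasDerivAt.comp t h1
    have e : ((fun R' => f R' p.2) ∘ fun t => Real.exp t * p.1) = fun t => f (Real.exp t * p.1) p.2 := by funext x; rfl
    rw [e] at h
    exact h.congr_deriv (by rw [mul_comm]; rfl)
  have hlim : ∀ p : ℝ × ℝ, Tendsto (fun h => g h p) (𝓝[≠] 0) (𝓝 (g₀ p)) := by
    intro p
    have h := (hder p 0)
    rw [hasDerivAt_iff_tendsto_slope] at h
    simp only [Real.exp_zero, one_mul] at h
    refine h.congr' ?_
    filter_upwards [self_mem_nhdsWithin] with h hh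
    rw [slope_def_field, Real.exp_zero, one_mul, sub_zero, hg]
    simp only []
    rw [div_eq_inv_mul]
  -- the uniform bound `|g h p| ≤ M` for all `h ≠ 0`
  have hbound : ∀ h : ℝ, h ≠ 0 → ∀ p : ℝ × ℝ, |g h p| ≤ M := by
    intro h hh p
    have hlip := Convex.norm_image_sub_le_of_norm_deriv_le (f := fun t => f (Real.exp t * p.1) p.2) (s := univ) (C := M)
      (fun t _ => (hder p t).differentiableAt) (fun t _ => ?_) convex_univ (mem_univ 0) (mem_univ h)
    · simp only [Real.exp_zero, one_mul, sub_zero, Real.norm_eq_abs] at hlip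
      simp only [hg, abs_mul, abs_inv]
      rw [inv_mul_le_iff₀ (abs_pos.2 hh)]
      linarith [hlip]
    · rw [(hder p t).deriv, Real.norm_eq_abs]
      have := hM' (Real.exp t * p.1, p.2)
      simpa [mul_assoc] using this
  -- the compact set carrying everything for `|h| ≤ 1`
  obtain ⟨K, hK, hKsupp⟩ := exists_compact_dil_sweep (f := uncurry f) hs
  have hK0 : ∀ p, p ∉ K → f p.1 p.2 = 0 := fun p hp => by
    by_contra h
    refine hp (hKsupp 0 (by norm_num) p ?_)
    rw [Real.exp_zero, dil_one]; exact h
  have hKh : ∀ h ∈ Icc (-1:ℝ) 1, ∀ p, p ∉ K → f (Real.exp h * p.1) p.2 = 0 := fun h hh p hp => by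
    by_contra h'
    exact hp (hKsupp h hh p h')
  have hKg₀ : ∀ p, p ∉ K → g₀ p = 0 := fun p hp => by
    -- `f ≡ 0` on the open set `Kᶜ` near `p`, so `∂_Rf(p) = 0`
    simp only [hg₀]
    have hopen : IsOpen Kᶜ := hK.isClosed.isOpen_compl
    have h0 : (fun R' => f R' p.2) =ᶠ[𝓝 p.1] fun _ => 0 := by
      have : {R' | (R', p.2) ∈ Kᶜ} ∈ 𝓝 p.1 := (hopen.preimage (Continuous.prodMk_left p.2)).mem_nhds hp
      filter_upwards [this] with R' hR'
      exact hK0 (R', p.2) hR'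
    show p.1 * deriv (fun R' => f R' p.2) p.1 = 0
    rw [h0.deriv_eq, deriv_const, mul_zero]
  -- dominated convergence for `∫_strip (g h − g₀)²`
  have hint : Tendsto (fun h => ∫ p in strip, (g h p - g₀ p) ^ 2) (𝓝[≠] 0) (𝓝 (∫ p in strip, (fun _ => (0:ℝ)) p)) := by
    refine tendsto_integral_filter_of_dominated_convergence (fun p => (2 * M) ^ 2 * K.indicator (fun _ => (1:ℝ)) p) ?_ ?_ ?_ ?_
    · exact Eventually.of_forall fun h => ((cg h).sub cg₀).pow 2 |>.aestronglyMeasurable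
    · have hmem : {h : ℝ | h ≠ 0} ∩ Icc (-1:ℝ) 1 ∈ 𝓝[≠] (0:ℝ) :=
        inter_mem_nhdsWithin _ (Icc_mem_nhds (by norm_num : (-1:ℝ) < 0) (by norm_num : (0:ℝ) < 1))
      filter_upwards [hmem] with h hh
      replace hh : h ∈ Icc (-1:ℝ) 1 ∧ h ≠ 0 := ⟨hh.2, hh.1⟩
      refine ae_of_all _ fun p => ?_
      rw [Real.norm_eq_abs, abs_pow, sq_abs]
      by_cases hp : p ∈ K
      · rw [indicator_of_mem hp, mul_one]
        have h1 := hbound h hh.2 p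
        have h2 : |g₀ p| ≤ M := hM' p
        have h3 : |g h p - g₀ p| ≤ 2 * M := (abs_sub _ _).trans (by linarith)
        nlinarith [abs_nonneg (g h p - g₀ p), sq_abs (g h p - g₀ p)]
      · rw [indicator_of_notMem hp, mul_zero]
        have e1 : g h p = 0 := by simp only [hg, hKh h hh.1 p hp, hK0 p hp, sub_zero, mul_zero]
        rw [e1, hKg₀ p hp]; norm_num
    · exact ((integrableOn_const_iff (C := (1:ℝ))).2 (Or.inr hK.measure_lt_top) |>.integrable_indicator hK.measurableSet).const_mul _
        |>.integrableOn
    · exact ae_of_all _ fun p => by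
        have := ((hlim p).sub_const (g₀ p)).pow 2
        simpa using this
  have hint0 : Tendsto (fun h => ∫ p in strip, (g h p - g₀ p) ^ 2) (𝓝[≠] 0) (𝓝 0) := by simpa using hint
  -- conclude in `L²`
  have sgh : ∀ h, HasCompactSupport (g h) := fun h => by
    have s1 : HasCompactSupport fun p : ℝ × ℝ => f (Real.exp h * p.1) p.2 := by
      have := hs.comp_homeomorph (dilHomeo (Real.exp_pos h).ne')
      exact this
    have s2 : HasCompactSupport fun p : ℝ × ℝ => f (Real.exp h * p.1) p.2 - f p.1 p.2 := s1.sub hs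
    exact s2.mul_left
  have mg : ∀ h, MemLp (g h) 2 stripMeasure := fun h => memLp_strip_of_continuous (cg h) (sgh h)
  have mg₀ : MemLp g₀ 2 stripMeasure := memLp_strip_of_continuous cg₀ sg₀
  rw [tendsto_iff_norm_sub_tendsto_zero]
  have e : ∀ h, ‖toL2 (g h) - toL2 g₀‖ = Real.sqrt (∫ p in strip, (g h p - g₀ p) ^ 2) := fun h => by
    have hsub : toL2 (g h) - toL2 g₀ = toL2 (g h - g₀) := by
      rw [toL2_eq_toLp (mg h), toL2_eq_toLp mg₀, toL2_eq_toLp ((mg h).sub mg₀)]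
      exact (MemLp.toLp_sub (mg h) mg₀).symm
    rw [hsub, ← Real.sqrt_sq (norm_nonneg _), norm_toL2_sq ((mg h).sub mg₀)]
    rfl
  rw [show (fun h => ‖toL2 (g h) - toL2 g₀‖) = fun h => Real.sqrt (∫ p in strip, (g h p - g₀ p) ^ 2) from funext e]
  have h := (Real.continuous_sqrt.tendsto 0).comp hint0
  rwa [Real.sqrt_zero] at h

/-- `toL2` is compatible with differences. [folklore] -/
theorem toL2_sub {u v : ℝ × ℝ → ℝ} (hu : MemLp u 2 stripMeasure) (hv : MemLp v 2 stripMeasure) : toL2 (u - v) = toL2 u - toL2 v := by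
  rw [toL2_eq_toLp (hu.sub hv), toL2_eq_toLp hu, toL2_eq_toLp hv]; exact MemLp.toLp_sub hu hv

/-- The difference quotient of the datum `toL2 f` along dilations is `toL2` of the difference quotient. [folklore] -/
theorem diffQuot_dilL2_toL2 {f : ℝ → ℝ → ℝ} (hf : ContDiff ℝ 1 (uncurry f)) (hs : HasCompactSupport (uncurry f)) (h : ℝ) :
    h⁻¹ • (dilL2 (Real.exp_pos h) (toL2 fun p : ℝ × ℝ => f p.1 p.2) - toL2 fun p : ℝ × ℝ => f p.1 p.2) =
      toL2 fun p : ℝ × ℝ => h⁻¹ * (f (Real.exp h * p.1) p.2 - f p.1 p.2) := by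
  have m0 : MemLp (fun p : ℝ × ℝ => f p.1 p.2) 2 stripMeasure := memLp_strip_of_continuous hf.continuous hs
  have m1 : MemLp (fun p : ℝ × ℝ => f (Real.exp h * p.1) p.2) 2 stripMeasure := by
    have := memLp_comp_dil (Real.exp_pos h) m0; exact this
  rw [dilL2_toL2 (Real.exp_pos h) m0]
  have e1 : ((fun p : ℝ × ℝ => f p.1 p.2) ∘ dil (Real.exp h)) = fun p : ℝ × ℝ => f (Real.exp h * p.1) p.2 := by funext p; rfl
  rw [e1, ← toL2_sub m1 m0, ← toL2_smul h⁻¹ (m1.sub m0)]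
  congr 1

/-- **The radial derivative of a weak solution**: for a `C¹_c` datum `f`, the difference quotients
`h⁻¹(dilE(e^h)U − U)` of the weak solution with datum `f` converge in `E⁴`, as `h → 0`, to the weak
solution with datum `R∂_Rf`. [cite: Elgindi2021, §7.3 proof of Proposition 7.7 Step 3 ("D_R commutes with the equation"); EGM arXiv:1910.14071 proof of Theorem 3 (p. 13)] -/
theorem tendsto_diffQuot_weakSol {α : ℝ} (hα : 0 < α) (hα1 : α ≤ 1) {f : ℝ → ℝ → ℝ} (hf : ContDiff ℝ 1 (uncurry f))
    (hs : HasCompactSupport (uncurry f)) {U U' : E4} (hU : IsWeakSol α (toL2 fun p : ℝ × ℝ => f p.1 p.2) U)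
    (hU' : IsWeakSol α (toL2 fun p : ℝ × ℝ => p.1 * dz f p.1 p.2) U') :
    Tendsto (fun h : ℝ => h⁻¹ • (dilE (Real.exp_pos h) U - U)) (𝓝[≠] 0) (𝓝 U') := by
  set c : ℝ := min (1 / 2) (2 * α) with hc
  have hc0 : 0 < c := lt_min (by norm_num) (by linarith)
  -- `W h = h⁻¹(dilE U − U) − U'` is the weak solution with datum `G h = toL2 (g h) − toL2 g₀`
  have hW : ∀ h : ℝ, IsWeakSol α (toL2 (fun p : ℝ × ℝ => h⁻¹ * (f (Real.exp h * p.1) p.2 - f p.1 p.2)) - toL2 fun p : ℝ × ℝ => p.1 * dz f p.1 p.2)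
      (h⁻¹ • (dilE (Real.exp_pos h) U - U) - U') := fun h => by
    have h1 := ((hU.dilE (Real.exp_pos h)).sub hU).smul h⁻¹
    rw [diffQuot_dilL2_toL2 hf hs h] at h1
    exact h1.sub hU'
  have hbd : ∀ h : ℝ, ‖h⁻¹ • (dilE (Real.exp_pos h) U - U) - U'‖ ≤
      c⁻¹ * ‖toL2 (fun p : ℝ × ℝ => h⁻¹ * (f (Real.exp h * p.1) p.2 - f p.1 p.2)) - toL2 fun p : ℝ × ℝ => p.1 * dz f p.1 p.2‖ := by
    intro h
    have := (hW h).norm_le hα hα1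
    rw [← hc] at this
    rw [le_inv_mul_iff₀ hc0]
    exact this
  have hG : Tendsto (fun h : ℝ => ‖toL2 (fun p : ℝ × ℝ => h⁻¹ * (f (Real.exp h * p.1) p.2 - f p.1 p.2)) - toL2 fun p : ℝ × ℝ => p.1 * dz f p.1 p.2‖)
      (𝓝[≠] 0) (𝓝 0) := (tendsto_iff_norm_sub_tendsto_zero.1 (tendsto_diffQuot_toL2 hf hs))
  rw [tendsto_iff_norm_sub_tendsto_zero]
  refine squeeze_zero (fun h => norm_nonneg _) hbd ?_
  simpa using hG.const_mul c⁻¹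

/-- `h ↦ −h` maps the punctured neighbourhood of `0` to itself. [folklore] -/
theorem tendsto_neg_nhdsNE_zero : Tendsto (fun h : ℝ => -h) (𝓝[≠] 0) (𝓝[≠] 0) := by
  refine tendsto_nhdsWithin_iff.2 ⟨?_, ?_⟩
  · have := (continuous_neg : Continuous fun h : ℝ => -h).tendsto 0
    rw [neg_zero] at this
    exact this.mono_left nhdsWithin_le_nhds
  · filter_upwards [self_mem_nhdsWithin] with h hh
    simpa using hh

/-- `(e^{−h} − 1)/h → −1`. [folklore] -/
theorem tendsto_exp_neg_sub_one_div : Tendsto (fun h : ℝ => h⁻¹ * (Real.exp (-h) - 1)) (𝓝[≠] 0) (𝓝 (-1)) := by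
  have h : HasDerivAt (fun h : ℝ => Real.exp (-h)) (-1) 0 := by
    have h1 : HasDerivAt (fun h : ℝ => -h) (-1) 0 := hasDerivAt_neg (0:ℝ)
    exact h1.exp.congr_deriv (by simp)
  rw [hasDerivAt_iff_tendsto_slope] at h
  refine h.congr' ?_
  filter_upwards [self_mem_nhdsWithin] with x hx
  rw [slope_def_field, neg_zero, Real.exp_zero, sub_zero, div_eq_inv_mul]

set_option maxHeartbeats 1600000 in
/-- **The radial derivative is the distributional `R∂_R`, componentwise**: if
`h⁻¹(dilE(e^h)U − U) → U'` in `E⁴` then `⟨U'_k, φ⟩ = −⟨U_k, φ + R∂_Rφ⟩` for every `C¹_c` test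
function `φ`. [folklore] -/
theorem inner_radialDeriv_component {U U' : E4} (hlim : Tendsto (fun h : ℝ => h⁻¹ • (dilE (Real.exp_pos h) U - U)) (𝓝[≠] 0) (𝓝 U'))
    {φ : ℝ → ℝ → ℝ} (hφ : ContDiff ℝ 1 (uncurry φ)) (hφs : HasCompactSupport (uncurry φ)) (k : Fin 4) :
    ⟪U' k, toL2 fun p : ℝ × ℝ => φ p.1 p.2⟫_ℝ = -⟪U k, toL2 fun p : ℝ × ℝ => φ p.1 p.2 + p.1 * dz φ p.1 p.2⟫_ℝ := by
  set Φ : L2Strip := toL2 fun p : ℝ × ℝ => φ p.1 p.2 with hΦ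
  have mφ : MemLp (fun p : ℝ × ℝ => φ p.1 p.2) 2 stripMeasure := memLp_strip_of_continuous hφ.continuous hφs
  have mD : MemLp (fun p : ℝ × ℝ => p.1 * dz φ p.1 p.2) 2 stripMeasure :=
    memLp_strip_of_continuous (by have := (contDiff_dz_of_contDiff (n := 0) hφ).continuous; fun_prop)
      ((hasCompactSupport_dz hφs).mul_left)
  -- limit 1: by continuity
  have L1 : Tendsto (fun h : ℝ => ⟪(h⁻¹ • (dilE (Real.exp_pos h) U - U)) k, Φ⟫_ℝ) (𝓝[≠] 0) (𝓝 ⟪U' k, Φ⟫_ℝ) :=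
    ((PiLp.proj (𝕜 := ℝ) 2 (fun _ : Fin 4 => L2Strip) k).continuous.inner continuous_const).tendsto U' |>.comp hlim
  -- the algebraic rewriting of the same quantity
  set T : ℝ → L2Strip := fun h => toL2 fun p : ℝ × ℝ => (-h)⁻¹ * (φ (Real.exp (-h) * p.1) p.2 - φ p.1 p.2) with hT
  have hTlim : Tendsto T (𝓝[≠] 0) (𝓝 (toL2 fun p : ℝ × ℝ => p.1 * dz φ p.1 p.2)) :=
    (tendsto_diffQuot_toL2 hφ hφs).comp tendsto_neg_nhdsNE_zero
  have halg : ∀ h : ℝ, h ≠ 0 → ⟪(h⁻¹ • (dilE (Real.exp_pos h) U - U)) k, Φ⟫_ℝ =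
      Real.exp (-h) * (-⟪U k, T h⟫_ℝ) + (h⁻¹ * (Real.exp (-h) - 1)) * ⟪U k, Φ⟫_ℝ := by
    intro h hh
    have e1 : (h⁻¹ • (dilE (Real.exp_pos h) U - U)) k = h⁻¹ • (dilL2 (Real.exp_pos h) (U k) - U k) := by
      simp only [PiLp.smul_apply, PiLp.sub_apply, dilE_apply]
    rw [e1, inner_smul_left, inner_sub_left, inner_dilL2 (Real.exp_pos h)]
    -- `dilL2 (e^h)⁻¹ Φ = toL2 (φ ∘ dil e^{−h})`
    have e2 : dilL2 (inv_pos.2 (Real.exp_pos h)) Φ = toL2 fun p : ℝ × ℝ => φ (Real.exp (-h) * p.1) p.2 := by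
      rw [hΦ, dilL2_toL2 _ mφ]
      congr 1
      funext p
      show φ ((Real.exp h)⁻¹ * p.1) p.2 = φ (Real.exp (-h) * p.1) p.2
      rw [Real.exp_neg]
    rw [e2]
    -- `T h = (−h)⁻¹ • (toL2 (φ∘dil) − Φ)`
    have m1 : MemLp (fun p : ℝ × ℝ => φ (Real.exp (-h) * p.1) p.2) 2 stripMeasure := by
      have := memLp_comp_dil (Real.exp_pos (-h)) mφ; exact this
    have e3 : T h = (-h)⁻¹ • ((toL2 fun p : ℝ × ℝ => φ (Real.exp (-h) * p.1) p.2) - Φ) := by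
      rw [hT, hΦ, ← toL2_sub m1 mφ, ← toL2_smul _ (m1.sub mφ)]
      congr 1
    rw [e3, inner_smul_right, inner_sub_right, Real.exp_neg]
    simp only [RCLike.conj_to_real]
    field_simp
    ring
  have L2 : Tendsto (fun h : ℝ => ⟪(h⁻¹ • (dilE (Real.exp_pos h) U - U)) k, Φ⟫_ℝ) (𝓝[≠] 0)
      (𝓝 (Real.exp (-0) * (-⟪U k, toL2 fun p : ℝ × ℝ => p.1 * dz φ p.1 p.2⟫_ℝ) + (-1) * ⟪U k, Φ⟫_ℝ)) := by
    have t1 : Tendsto (fun h : ℝ => Real.exp (-h)) (𝓝[≠] 0) (𝓝 (Real.exp (-0))) :=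
      ((Real.continuous_exp.comp continuous_neg).tendsto 0).mono_left nhdsWithin_le_nhds
    have t2 : Tendsto (fun h : ℝ => -⟪U k, T h⟫_ℝ) (𝓝[≠] 0) (𝓝 (-⟪U k, toL2 fun p : ℝ × ℝ => p.1 * dz φ p.1 p.2⟫_ℝ)) :=
      ((continuous_const.inner continuous_id).tendsto _ |>.comp hTlim).neg
    have t3 := tendsto_exp_neg_sub_one_div
    have t := (t1.mul t2).add (t3.mul_const ⟪U k, Φ⟫_ℝ)
    refine t.congr' ?_
    filter_upwards [self_mem_nhdsWithin] with h hh
    exact (halg h hh).symm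
  have := tendsto_nhds_unique L1 L2
  have eadd : (toL2 fun p : ℝ × ℝ => φ p.1 p.2 + p.1 * dz φ p.1 p.2) = Φ + toL2 fun p : ℝ × ℝ => p.1 * dz φ p.1 p.2 := by
    rw [hΦ, ← toL2_add mφ mD]; rfl
  rw [this, neg_zero, Real.exp_zero, one_mul, neg_one_mul, eadd, inner_add_right]
  ring

end Elgindi

end Literature.Analysis.FluidPDE
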